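import Summits.HodgeConjecture.CorCM.Census.CentralSquaresCompanion

/-!
# The square-central class, XXV: the transversal relations for a BASE-INVOLUTIVE swap (`T₁·Q⁻¹ = T₀` in place of `Q² = 1`)

COR-CM (cell `pub-hodgecm2`), count-neutral kernel combinatorics by the binder seat b09 (gen 46; lane SQUARE-CENTRAL CLASS, part XXV), re-running parts IV §2
(`single_sub_thetaG_mem_transversal`), VI §2–3 (`single_sub_thetaG_mem_transversal_exchange`, `rel_transversal_mem`) and VII §3 (`relc_mem`) with the single use
of `Q² = 1` they make — `T₁·Q⁻¹ = T₀` (resp. `(cQ)² = 1 ⟹ T̄₁·(cQ)⁻¹ = T₀`) — turned into the hypothesis `hQ₁ : rt c Q T₁ = T₀`; everything else (parts I, III, V: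
`rt_eq_self_of_transversal`, `cover_frame`, `swap_preserves_frame`, `transversal_frame`, `companion_*`) is used BY NAME.  Theorems only: no definition, no `decide`,
no certificate, no named fact, no `sorry`.  HONEST FRAMING: `HC_CM` is NOT proved, here or anywhere in the tree; nothing here is a period or a headline.

WHY (design note `CENTRAL-SQUARES-M2.md` §5): in the last dihedral-quotient rows of order 16, `ℤ/4 ⋊ ℤ/4` with `c = a²` or `a²y²`, every lift `q` of a
reflection has `q² = z`, the kernel involution; the swap `Q = q` still satisfies `T₀·Q⁻¹ = T₁` AND `T₁·Q⁻¹ = T₀` (`Q² = z ∈ Stab T₀ ∩ Stab T₁`), but its place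
permutation `σ_Q` has order `4` (`σ_Q² =` the place action of `z`).  The transversal condition `t ∈ T ↔ σ_Q t ∉ T` then selects the `σ_Q²`-stable halves of
the `σ_Q`-cycles, the transversal type is still `Q`-stable (part III `rt_eq_self_of_transversal` never used `Q² = 1`), and the two star normal forms of it give
`R(T) ∈ L` exactly as in part VI; the companion swap `cQ` has `T̄₁·(cQ)⁻¹ = T₀` (`companion_rt₁`), whence `Rᶜ(T') ∈ L` as in part VII.

* §1 `single_sub_thetaG_mem_transversal'` (part IV §2), §2 `single_sub_thetaG_mem_transversal_exchange'`, `rel_transversal_mem'` (part VI), §3 `companion_rt₁`,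
  `relc_mem'` (part VII).

## References
* [Pohlmann1968] H. Pohlmann, Algebraic cycles on abelian varieties of complex multiplication type, Ann. of Math. 88 (1968), Thm 1.
-/

namespace Summit.HodgeConjecture.CorCM.Census.CentralSquares

open Finset
open scoped symmDiff
open Summit.HodgeConjecture.CorCM.Prior.AllgGroup.RfwfAllgGroup
open Summit.HodgeConjecture.CorCM.Census.BlockParity
open Summit.HodgeConjecture.CorCM.Census.Coinvariant
open Summit.HodgeConjecture.CorCM.Census.TwistGeneration
open Summit.HodgeConjecture.CorCM.Census.BaseBlock
open Summit.HodgeConjecture.CorCM.Census.CoverClosure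

noncomputable section

variable {G : Type*} [Group G] [Fintype G] [DecidableEq G] (c : G)

section Frame

variable (hc2 : c * c = 1) (hcen : ∀ x : G, x * c = c * x) (T₀ T₁ : CMF G c)
variable (hbase : ∀ Q : G, rt c Q T₀ = T₀ ∨ rt c Q T₀ = rt c c T₀ ∨ rt c Q T₀ = T₁ ∨ rt c Q T₀ = rt c c T₁)
variable (m : ℕ) (hn : T₀.1.card = 4 * m) (hH : (T₀.1 \ T₁.1).card = 2 * m)
variable (Q : G) (hQ : rt c Q T₀ = T₁) (hQ₁ : rt c Q T₁ = T₀)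
variable (hσH : ∀ t ∈ T₀.1, ∀ t' ∈ T₀.1, (t' = t * Q ∨ t' = c * (t * Q)) → (t ∈ T₀.1 \ T₁.1 ↔ t' ∈ T₀.1 \ T₁.1))
variable (L : Submodule ℤ (CMF G c →₀ ℤ)) (hLrt : ∀ (Q' : G) (y : CMF G c →₀ ℤ), y ∈ L → Finsupp.mapDomain (rt c Q') y ∈ L)
variable (hcover : ∀ Ψ : CMF G c, 2 ≤ bpot c T₀ Ψ → ∃ Q₂ s s' : G, bpot c T₀ Ψ = ddist (rt c Q₂ T₀) Ψ ∧
    s ∈ (rt c Q₂ T₀).1 \ Ψ.1 ∧ s' ∈ (rt c Q₂ T₀).1 \ Ψ.1 ∧ s ≠ s' ∧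
    gface c hc2 Ψ s s' ∈ L ∧
    ((∃ Q₁ t t' : G, bpot c T₀ Ψ = ddist (rt c Q₁ T₀) Ψ ∧ t ∈ (rt c Q₁ T₀).1 \ Ψ.1 ∧ t' ∈ (rt c Q₁ T₀).1 \ Ψ.1 ∧ t ≠ t' ∧
        (∀ Q' : G, ddist (rt c Q' T₀) (oflipCM c hc2 t Ψ) = bpot c T₀ (oflipCM c hc2 t Ψ) → rt c Q' T₀ = rt c Q₁ T₀) ∧
        (∀ Q' : G, ddist (rt c Q' T₀) (oflipCM c hc2 t' Ψ) = bpot c T₀ (oflipCM c hc2 t' Ψ) → rt c Q' T₀ = rt c Q₁ T₀) ∧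
        (∀ Q' : G, ddist (rt c Q' T₀) (oflipCM c hc2 t (oflipCM c hc2 t' Ψ)) = bpot c T₀ (oflipCM c hc2 t (oflipCM c hc2 t' Ψ)) →
          rt c Q' T₀ = rt c Q₁ T₀)) →
      (∀ Q' : G, ddist (rt c Q' T₀) (oflipCM c hc2 s Ψ) = bpot c T₀ (oflipCM c hc2 s Ψ) → rt c Q' T₀ = rt c Q₂ T₀) ∧
      (∀ Q' : G, ddist (rt c Q' T₀) (oflipCM c hc2 s' Ψ) = bpot c T₀ (oflipCM c hc2 s' Ψ) → rt c Q' T₀ = rt c Q₂ T₀) ∧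
      (∀ Q' : G, ddist (rt c Q' T₀) (oflipCM c hc2 s (oflipCM c hc2 s' Ψ)) = bpot c T₀ (oflipCM c hc2 s (oflipCM c hc2 s' Ψ)) →
        rt c Q' T₀ = rt c Q₂ T₀)))

/-! ## §1 Level `m`: the transversal type (part IV §2) -/

include hcen hbase hn hH hQ hQ₁ hσH hLrt hcover in
/-- **STAR NORMAL FORM OF A TRANSVERSAL TYPE.**  For a transversal `T ⊆ 𝓗` of the swap (`t ∈ T ↔ σ_Q t ∉ T` on `𝓗`) of size `m ≥ 2` — BASE-INVOLUTIVE swap (`T₁·Q⁻¹ = T₀` instead of `Q² = 1`), every type `X` with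
deviation set `D(X) ⊆ T` satisfies `[X] − θ_{T₀}(typeSum [X]) ∈ L`; in particular the transversal type itself (`m ≥ 2`). [folklore] -/
theorem single_sub_thetaG_mem_transversal' (hm : 2 ≤ m) (T : Finset G) (hTH : T ⊆ T₀.1 \ T₁.1) (hTm : T.card = m)
    (hT : ∀ t ∈ T₀.1 \ T₁.1, ∀ t' ∈ T₀.1, (t' = t * Q ∨ t' = c * (t * Q)) → (t ∈ T ↔ t' ∉ T)) :
    ∀ X : CMF G c, T₀.1 \ X.1 ⊆ T → Finsupp.single X 1 - thetaG c hc2 T₀ (typeSum G c (Finsupp.single X 1)) ∈ L := by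
  refine single_sub_thetaG_mem_of c T₀ (fun X => T₀.1 \ X.1 ⊆ T) hc2 L fun X hX h2 => ?_
  -- corners stay in the class
  have hcorner : ∀ s ∈ T₀.1 \ X.1, T₀.1 \ (oflipCM c hc2 s X).1 ⊆ T := fun s hs =>
    (dev_oflip c hc2 (mem_sdiff.mp hs).1 (mem_sdiff.mp hs).2).symm ▸ (erase_subset _ _).trans hX
  have hcorner2 : ∀ s ∈ T₀.1 \ X.1, ∀ s' ∈ T₀.1 \ X.1, s ≠ s' → T₀.1 \ (oflipCM c hc2 s (oflipCM c hc2 s' X)).1 ⊆ T := by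
    intro s hs s' hs' hss'
    have hs'' : s ∈ T₀.1 \ (oflipCM c hc2 s' X).1 := by
      rw [dev_oflip c hc2 (mem_sdiff.mp hs').1 (mem_sdiff.mp hs').2]; exact mem_erase.mpr ⟨hss', hs⟩
    exact (dev_oflip c hc2 (mem_sdiff.mp hs'').1 (mem_sdiff.mp hs'').2).symm ▸ (erase_subset _ _).trans (hcorner s' hs')
  by_cases hXT : T₀.1 \ X.1 = T
  · -- the transversal type itself: a tie between `T₀` and `T₁`; the cover face or its `Q`-translate is toward `T₀`
    have hbp : bpot c T₀ X = m := by
      have hsd : ((T₀.1 \ T₁.1) ∆ (T₀.1 \ X.1)).card = m := by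
        rw [hXT, symmDiff_of_ge hTH, card_sdiff_of_subset hTH, hH, hTm]; omega
      rw [← hTm, ← hXT]
      refine bpot_eq_card_dev_of_le c T₀ T₁ hbase hc2 hcen X ?_ ?_ ?_
      · rw [hXT, hTm, hn]; omega
      · rw [hsd, hXT, hTm]
      · rw [hsd, hn, hXT, hTm]; omega
    obtain ⟨Q₂, s, s', hQ₂, hs, hs', hss', hmem, -⟩ := hcover X (by rw [hbp]; omega)
    -- `rt Q₂ T₀` is `T₀` or `T₁`
    have hQ₂' : rt c Q₂ T₀ = T₀ ∨ rt c Q₂ T₀ = T₁ := by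
      rcases hbase Q₂ with h | h | h | h
      · exact Or.inl h
      · exfalso; rw [h, ddist_compl_base_eq c T₀ hc2 hcen, hbp, hn, hXT, hTm] at hQ₂; omega
      · exact Or.inr h
      · exfalso
        rw [h, ddist_compl_eq c T₀ hc2 hcen, hbp, hn, hXT, symmDiff_of_ge hTH, card_sdiff_of_subset hTH, hH, hTm] at hQ₂; omega
    rcases hQ₂' with h0 | h1
    · rw [h0] at hs hs'
      exact ⟨s, s', hs, hs', hss', hmem, hcorner s hs, hcorner s' hs', hcorner2 s hs s' hs' hss'⟩
    · -- translate the face by `Q`: `X` is `Q`-stable and `T₁·Q⁻¹ = T₀`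
      have hstab : rt c Q X = X :=
        rt_eq_self_of_transversal c T₀ Q (T₀.1 \ T₁.1) (by rw [hQ]) hσH X T ∅ (by rw [union_empty]; exact hXT) hTH
          (empty_subset _) hT (fun t _ t' _ _ => by simp)
      have hmem' : gface c hc2 X (s * Q⁻¹) (s' * Q⁻¹) ∈ L := by
        have e : gface c hc2 X (s * Q⁻¹) (s' * Q⁻¹) = Finsupp.mapDomain (rt c Q) (gface c hc2 X s s') := by
          rw [mapDomain_rt_gface, hstab]
        rw [e]; exact hLrt Q _ hmem
      have hsQ : s * Q⁻¹ ∈ T₀.1 \ X.1 := by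
        rw [← hQ₁, ← hstab, mem_sdiff_rt_iff, inv_mul_cancel_right, ← h1]; exact hs
      have hs'Q : s' * Q⁻¹ ∈ T₀.1 \ X.1 := by
        rw [← hQ₁, ← hstab, mem_sdiff_rt_iff, inv_mul_cancel_right, ← h1]; exact hs'
      have hne : s * Q⁻¹ ≠ s' * Q⁻¹ := fun h => hss' (mul_right_cancel h)
      exact ⟨_, _, hsQ, hs'Q, hne, hmem', hcorner _ hsQ, hcorner _ hs'Q, hcorner2 _ hsQ _ hs'Q hne⟩
  · -- strictly inside `T`: unique nearest base change `T₀`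
    have hlt : (T₀.1 \ X.1).card < m := by
      rw [← hTm]; exact card_lt_card (lt_of_le_of_ne hX hXT |> fun h => h)
    obtain ⟨hbp, huniq⟩ := unique_T₀_of_subset_H c hc2 hcen T₀ T₁ hbase m hn hH X (hX.trans hTH) hlt
    obtain ⟨s, s', hs, hs', hss', hmem⟩ := face_toward_T₀ c hc2 T₀ L hcover X (by rw [hbp]; exact h2) huniq
    exact ⟨s, s', hs, hs', hss', hmem, hcorner s hs, hcorner s' hs', hcorner2 s hs s' hs' hss'⟩


/-! ## §2 The exchanged frame and the transversal relation (part VI) -/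

include hcen hbase hn hH hQ hQ₁ hσH hLrt hcover in
/-- **STAR NORMAL FORM TOWARD `T₁` OF THE TRANSVERSAL TYPE** — part IV in the exchanged frame `(T₁; T₀, Q)`, base-involutive swap: for a transversal `T ⊆ 𝓗` of size `m ≥ 2`,
every type whose `T₁`-deviation set lies in `c·(𝓗 ∖ T)` has `[X] − θ_{T₁}(typeSum [X]) ∈ L`. [folklore] -/
theorem single_sub_thetaG_mem_transversal_exchange' (T : Finset G) (hTH : T ⊆ T₀.1 \ T₁.1) (hTm : T.card = m)
    (hT : ∀ t ∈ T₀.1 \ T₁.1, ∀ t' ∈ T₀.1, (t' = t * Q ∨ t' = c * (t * Q)) → (t ∈ T ↔ t' ∉ T)) (hm : 2 ≤ m) :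
    ∀ X : CMF G c, T₁.1 \ X.1 ⊆ ((T₀.1 \ T₁.1) \ T).image (fun x => c * x) →
      Finsupp.single X 1 - thetaG c hc2 T₁ (typeSum G c (Finsupp.single X 1)) ∈ L := by
  have hcov := cover_frame c hc2 T₀ L Q hcover
  simp only [hQ] at hcov
  have hH₁ : (T₁.1 \ T₀.1).card = 2 * m := by rw [card_sdiff_frame c hc2 T₀ T₁, hH]
  have hsub : ((T₀.1 \ T₁.1) \ T).image (fun x => c * x) ⊆ T₁.1 \ T₀.1 := by
    intro x hx
    obtain ⟨u, hu, rfl⟩ := mem_image.mp hx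
    obtain ⟨hu0, hu1⟩ := mem_sdiff.mp (mem_sdiff.mp hu).1
    exact mem_sdiff.mpr ⟨by by_contra h; exact hu1 ((T₁.2 u).mpr h), (T₀.2 u).mp hu0⟩
  have hcard : (((T₀.1 \ T₁.1) \ T).image (fun x => c * x)).card = m := by
    rw [card_image_of_injective _ (mul_right_injective c), card_sdiff_of_subset hTH, hH, hTm]; omega
  exact single_sub_thetaG_mem_transversal' c hc2 hcen T₁ T₀ (base_cases_exchange c hbase hQ) m (card_frame c hc2 T₀ T₁ m hn) hH₁ Q hQ₁ hQ
    (swap_preserves_frame c hc2 T₀ T₁ Q hσH) L hLrt hcov hm _ hsub hcard (transversal_frame c hc2 T₀ T₁ Q hσH T hT)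

include hcen hbase hn hH hQ hQ₁ hσH hLrt hcover in
/-- **THE TRANSVERSAL RELATION `R(T) ∈ L`** (`m ≥ 2`, base-involutive swap): for every transversal `T ⊆ 𝓗` of the swap with `|T| = m`,
`Σ_{s∈T} f_s − Σ_{u∈𝓗∖T} g_u − (m−1)·(e₀ − e₁) ∈ L`. [folklore] -/
theorem rel_transversal_mem' (T : Finset G) (hTH : T ⊆ T₀.1 \ T₁.1) (hTm : T.card = m)
    (hT : ∀ t ∈ T₀.1 \ T₁.1, ∀ t' ∈ T₀.1, (t' = t * Q ∨ t' = c * (t * Q)) → (t ∈ T ↔ t' ∉ T)) (hm : 2 ≤ m) :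
    ∑ s ∈ T, Finsupp.single (oflipCM c hc2 s T₀) (1 : ℤ) - ∑ u ∈ (T₀.1 \ T₁.1) \ T, Finsupp.single (oflipCM c hc2 u T₁) (1 : ℤ) -
      ((m : ℤ) - 1) • (Finsupp.single T₀ (1 : ℤ) - Finsupp.single T₁ 1) ∈ L := by
  obtain ⟨Φ, hΦ⟩ := exists_type_of_dev c hc2 T₀ T (hTH.trans sdiff_subset)
  -- the two star normal forms of `Φ`
  have h0 := single_sub_thetaG_mem_transversal' c hc2 hcen T₀ T₁ hbase m hn hH Q hQ hQ₁ hσH L hLrt hcover hm T hTH hTm hT Φ (by rw [hΦ])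
  have hdev₁ : T₁.1 \ Φ.1 = ((T₀.1 \ T₁.1) \ T).image (fun x => c * x) := by
    rw [sdiff_eq_of_dev c hc2 T₀ T₁ Φ, hΦ, Finset.sdiff_eq_empty_iff_subset.mpr hTH, empty_union]
  have h1 := single_sub_thetaG_mem_transversal_exchange' c hc2 hcen T₀ T₁ hbase m hn hH Q hQ hQ₁ hσH L hLrt hcover T hTH hTm hT hm Φ
    (by rw [hdev₁])
  -- their difference
  have hdiff := Submodule.sub_mem _ h1 h0
  rw [sub_sub_sub_cancel_left, thetaG_typeSum_single c T₀ hc2 Φ, thetaG_frame c hc2 T₀ T₁ Φ, hΦ,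
    Finset.sdiff_eq_empty_iff_subset.mpr hTH, sum_empty, zero_add] at hdiff
  have hcardD : (((T₀.1 \ T₁.1) \ T).card : ℤ) = m := by
    have h : ((T₀.1 \ T₁.1) \ T).card = m := by rw [card_sdiff_of_subset hTH, hH, hTm]; omega
    exact_mod_cast h
  have hTm' : (T.card : ℤ) = m := by exact_mod_cast hTm
  have e : ∑ s ∈ T, Finsupp.single (oflipCM c hc2 s T₀) (1 : ℤ) - ∑ u ∈ (T₀.1 \ T₁.1) \ T, Finsupp.single (oflipCM c hc2 u T₁) (1 : ℤ) -
      ((m : ℤ) - 1) • (Finsupp.single T₀ (1 : ℤ) - Finsupp.single T₁ 1) =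
      ((∑ t ∈ T, (Finsupp.single (oflipCM c hc2 t T₀) (1 : ℤ) - Finsupp.single T₀ 1)) + Finsupp.single T₀ 1) -
      ((∑ u ∈ (T₀.1 \ T₁.1) \ T, (Finsupp.single (oflipCM c hc2 u T₁) (1 : ℤ) - Finsupp.single T₁ 1)) + Finsupp.single T₁ 1) := by
    rw [sum_sub_distrib, sum_sub_distrib, sum_const, sum_const, ← Nat.cast_smul_eq_nsmul ℤ, ← Nat.cast_smul_eq_nsmul ℤ, hcardD, hTm']
    module
  rw [e]
  exact hdiff

/-! ## §3 The companion frame and `Rᶜ` (part VII) -/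

include hc2 hcen hQ₁ in
/-- `T̄₁·(cQ)⁻¹ = T₀` for a base-involutive swap: `rt (cQ) T̄₁ = rt (cQc) T₁ = rt Q T₁ = T₀`. [folklore] -/
theorem companion_rt₁ : rt c (c * Q) (rt c c T₁) = T₀ := by
  rw [← rt_mul, show c * Q * c = Q by rw [mul_assoc, hcen Q, ← mul_assoc, hc2, one_mul], hQ₁]

include hcen hbase hn hH hQ hQ₁ hσH hLrt hcover in
/-- **`Rᶜ(T') ∈ L`** (`m ≥ 2`, all pairs in `L`, base-involutive swap): for every transversal `T' ⊆ T₀ ∩ T₁` of the place permutation with `|T'| = m`,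
`Σ_{s∈T'} f_s + Σ_{u ∈ (T₀∩T₁)∖T'} g_u − (m−1)·(e₀ + e₁) ∈ L` — the transversal relation of the companion frame, modulo pairs. [folklore] -/
theorem relc_mem' (T' : Finset G) (hTH : T' ⊆ T₀.1 ∩ T₁.1) (hTm : T'.card = m)
    (hT : ∀ t ∈ T₀.1 ∩ T₁.1, ∀ t' ∈ T₀.1, (t' = t * Q ∨ t' = c * (t * Q)) → (t ∈ T' ↔ t' ∉ T')) (hP : ∀ Ψ : CMF G c, pair c Ψ ∈ L) (hm : 2 ≤ m) :
    ∑ s ∈ T', Finsupp.single (oflipCM c hc2 s T₀) (1 : ℤ) + ∑ u ∈ (T₀.1 ∩ T₁.1) \ T', Finsupp.single (oflipCM c hc2 u T₁) (1 : ℤ) -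
      ((m : ℤ) - 1) • (Finsupp.single T₀ (1 : ℤ) + Finsupp.single T₁ 1) ∈ L := by
  have hHc : T₀.1 \ (rt c c T₁).1 = T₀.1 ∩ T₁.1 := by
    rw [dev_compl c hcen T₀ T₁]; ext t; simp only [mem_sdiff, mem_inter, not_and, not_not]; tauto
  have hT2 : ∀ t ∈ T₀.1 \ (rt c c T₁).1, ∀ t' ∈ T₀.1, (t' = t * (c * Q) ∨ t' = c * (t * (c * Q))) → (t ∈ T' ↔ t' ∉ T') := by
    intro t ht t' ht' h
    rw [or_companion_iff c hc2 hcen Q] at h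
    rw [hHc] at ht
    exact hT t ht t' ht' h
  have h := rel_transversal_mem' c hc2 hcen T₀ (rt c c T₁) (companion_base c hc2 T₀ T₁ hbase) m hn (companion_card c hcen T₀ T₁ m hn hH)
    (c * Q) (companion_rt c T₀ T₁ Q hQ) (companion_rt₁ c hc2 hcen T₀ T₁ Q hQ₁) (companion_swap c hc2 hcen T₀ T₁ Q hσH) L hLrt
    hcover T' (by rw [hHc]; exact hTH) hTm hT2 hm
  rw [hHc] at h
  have hsr : ∀ X : CMF G c, Finsupp.single (rt c c X) (1 : ℤ) = pair c X - Finsupp.single X 1 := fun X => by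
    rw [pair, add_sub_cancel_left]
  simp only [oflipCM_rt_self c hc2 hcen, hsr] at h
  -- `h` : Σ f − Σ (pair − g) − (m−1)(e₀ − (pair T₁ − e₁)) ∈ L ; add the pairs back
  have hp1 : ∑ u ∈ (T₀.1 ∩ T₁.1) \ T', pair c (oflipCM c hc2 u T₁) ∈ L := Submodule.sum_mem _ fun u _ => hP _
  have hp2 : ((m : ℤ) - 1) • pair c T₁ ∈ L := Submodule.smul_mem _ _ (hP T₁)
  have hsum : ∑ u ∈ (T₀.1 ∩ T₁.1) \ T', (pair c (oflipCM c hc2 u T₁) - Finsupp.single (oflipCM c hc2 u T₁) (1 : ℤ)) =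
      ∑ u ∈ (T₀.1 ∩ T₁.1) \ T', pair c (oflipCM c hc2 u T₁) - ∑ u ∈ (T₀.1 ∩ T₁.1) \ T', Finsupp.single (oflipCM c hc2 u T₁) (1 : ℤ) :=
    sum_sub_distrib _ _
  rw [hsum] at h
  have e : ∑ s ∈ T', Finsupp.single (oflipCM c hc2 s T₀) (1 : ℤ) + ∑ u ∈ (T₀.1 ∩ T₁.1) \ T', Finsupp.single (oflipCM c hc2 u T₁) (1 : ℤ) -
      ((m : ℤ) - 1) • (Finsupp.single T₀ (1 : ℤ) + Finsupp.single T₁ 1) =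
      (∑ s ∈ T', Finsupp.single (oflipCM c hc2 s T₀) (1 : ℤ) -
        (∑ u ∈ (T₀.1 ∩ T₁.1) \ T', pair c (oflipCM c hc2 u T₁) - ∑ u ∈ (T₀.1 ∩ T₁.1) \ T', Finsupp.single (oflipCM c hc2 u T₁) (1 : ℤ)) -
        ((m : ℤ) - 1) • (Finsupp.single T₀ (1 : ℤ) - (pair c T₁ - Finsupp.single T₁ 1))) +
      ∑ u ∈ (T₀.1 ∩ T₁.1) \ T', pair c (oflipCM c hc2 u T₁) - ((m : ℤ) - 1) • pair c T₁ := by module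
  rw [e]
  exact Submodule.sub_mem _ (Submodule.add_mem _ h hp1) hp2

end Frame

end

end Summit.HodgeConjecture.CorCM.Census.CentralSquares
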